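import Summits.QuantumFields.YangMills.Theorems.UnitScaleTiltProp7SymAvgTwSymBridge
import Summits.QuantumFields.YangMills.Theorems.UnitScaleTiltProp7SymAvgRelDiffT3
import Summits.QuantumFields.YangMills.Theorems.UnitScaleTiltProp7SymFrameBound
import Summits.QuantumFields.YangMills.Theorems.UnitScaleTiltProp8ChartBridgeAllL
import Summits.QuantumFields.YangMills.Theorems.UnitScaleTiltProp7FirstVariationExactPairing
import Literature.MathematicalPhysics.QuantumFieldTheory.Balaban1983to89.Node00.CriticalOnFibre
import HarnessLib

/-!
# Route `UnitScaleTilt`, crux K1 «MinimiserStabilityRegPr» (stmt-QuantumFields-19200), route-R E′ architecture (A′) «HCOW-VIA-Σ» (★★OWNER RULING g28-№13), package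
# P-A1 «LEG LEMMA» — THE EX LANE'S SYMMETRIC LINEARISED AVERAGE `QSym` IS THE E′ LANE'S TRUE-LINEARISATION FAMILY `Q`, AND PRINT'S TWISTED `QTwS` DIFFERS FROM IT BY A
# COARSE PURE GAUGE: `QSym_W A c = Q^{(K−n)}_W A ĉ`, `QTwS_W A c = Q^{(K−n)}_W A ĉ − (r(c₋)A − Ū(ĉ)·r(c₊)A·Ū(ĉ)ᴴ)`

Cell `ym3-torus`, D-0154 (3c) twin-width seat `ym-routeR-w2` (gen 7), 2026-08-29.  ★p1 g17 LOCATE v2 §7 (A′) P-A1 (01:43Z «LEG LEMMA: `Q_W X − QTwS_W X = D_V̄(S_W X)` coarse pure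
gauge … routeR-w2 g7 (TrueLin families) — say LEG: MINE»), this seat's LOCATE `ym-routeR-w2/LOCATE-LEG-PA1-routeRw2g7.md` (19200 evidence #54).  THEOREMS ONLY (0 `def`, 0 `sorry`);
`--supports stmt-QuantumFields-19200 --as helper`, count-neutral.  YM₃ on T³ is a ladder rung (R3), not the Clay problem; nothing here claims the stub, the crux, `hcoW`, E′, EX, d = 4
or the mass gap.

THE POINT.  The product-rule half of LEG is landed (✓ `Prop7SymAvgTwSymBridge.QTwS_apply_eq`: `QTwS U₀ A c = QSym U₀ A c − (r c₋ A − D̄(U₀♭)(c)·r c₊ A·D̄(U₀♭)(c)⁻¹)`, `r` the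
linearised symmetric accumulated frames).  What the (A′) knit needs in addition is the identification of the EX lane's `QSym U₀ := fderiv ℂ (logChartSym U₀) 0` (the linear part of
`A ↦ log[D̄_GL(e^{A}U₀♭)(c)·D̄_GL(U₀♭)(c)⁻¹]`) with the E′ lane's ALGEBRAIC true-linearisation family `Q k` (`hQ0 ∕ hQs`, the letters in which the multiplier `λ_W` and the weak E–L
pairing `Lin_W(A) = Σ_c Re tr(λ c·Q (K−n) A c)` live, ✓ `exists_multiplier_field_weakEL`).  This file proves it at printed-regular backgrounds for 𝔰𝔲(2)-valued directions by a
one-variable chain rule over LANDED suppliers: along the `SU(2)` curve `s ↦ e^{sA}·W` the GL descent `D̄_GL` IS the `SU(2)` average of record (✓ `coe_emlIterU_unitsField_T3_allL`,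
plaquette-smallness holding for `s` near `0`), the ratio `avg^{K−n}(e^{sA}W)(ĉ)·avg^{K−n}(W)(ĉ)ᴴ` has derivative `Q (K−n) A ĉ` (this seat's g1 ✓ `Prop7TrueLinIterHasDeriv.hasDerivAt_iter_ratio`
under ✓ `tower_loop_rows_of_regPr`), `log′(1) = id` (✓ `hasFDerivAt_mlog_one`), and derivatives are unique.

WHAT IS PROVED (ns `…Theorems.Prop7QSymEqTrueLinIter`; T³, `SU(2)`).
* §1 `bgUnits_expCurve` (the chart configuration `b ↦ e^{sA b}·W♭ b` is the `SU(2)` curve read in units), `plaqSmall_expCurve_eventually` (it stays plaquette-small near `s = 0`),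
  `coe_descendToGL_bgUnits` ∕ `coe_descendToGL_bgUnits_inv` (the GL descent of an `SU(2)` field in the regime is the average of record; its inverse is the adjoint).
* §2 ★★★ `QSym_apply_eq_trueLinIter` — «QSYM = Q»: `QSym F n K h W A c = Q (K−n) A (bondShift (sites_eq F n K h) c)` for `RegPr F n K ε₀ W`, `10¹⁰L⁶ε₀ ≤ 1`, `A` 𝔰𝔲(2)-valued.
* §3 ★★★ `QTwS_apply_eq_trueLinIter_sub_coarseGauge` — LEG in E′ letters: `QTwS F n K h W A c = Q (K−n) A ĉ − (r c.src A − ↑(Ū ĉ)·r c.tgt A·(↑(Ū ĉ))ᴴ)`,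
  `Ū = Averaging.iter (blockAvg expMeanLogSU) (K−n) W`, `r y = fderiv ℂ (A ↦ ↑(frameTwS W A y)) 0` (window `10¹²L³ε₀ ≤ 1` for the frames).
HONEST SCOPE.  First-order bookkeeping at the background (no estimate); the displayed differentiability rows of the bridge are discharged by name at `RegPr`; nothing of print is asserted
beyond the cited tree theorems.

References: T. Bałaban, CMP 98 (1985) 17–51 [Balaban1985Averaging] ((11) p.19, (89)–(92) p.31, (97) p.32, Prop. 3 (122)–(127) p.36); CMP 99 (1985) 389–434
[Balaban1985BackgroundPropagators] (p.392, (3.13)–(3.15), (3.19) p.393); CMP 102 (1985) 277–309 [Balaban1985Variational] ((44)–(48) p.285, (141)–(143) p.299); CMP 109 (1987) 249–301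
[Balaban1987RG1] ((0.4), (0.11) p.253).
-/

set_option autoImplicit false

noncomputable section

open scoped BigOperators Matrix.Norms.L2Operator Topology

namespace Summit.QuantumFields.YangMills.Theorems.Prop7QSymEqTrueLinIter

open Filter NormedSpace
open Literature.MathematicalPhysics.QuantumFieldTheory.Balaban1983to89
open Literature.MathematicalPhysics.QuantumFieldTheory.Balaban1983to89.T3ContinuumYM3Torus
open T4Continuum BlockAveraging AveragingRT ExpMeanLog BlockAveragingEMLLinearised BlockAveragingEMLLinearisedBackground BlockAveragingEMLProp2
open T3PrintedRegularMinimiser (RegPr)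
open T3RegularMinimiser (regThreshold)
open T3LevelShift (siteShift bondShift)
open T3PrintedRegularOrbits (sites_eq)
open T3SectALandauChart (bgUnits)
open B10Eq27TorusAxialLog (unitsField toUField)
open B7Prop1Explicit (expUnit val_expUnit)
open MatrixLog (mlog)
open B7TransferAnalyticMean (hasFDerivAt_mlog_one)
open Literature.MathematicalPhysics.QuantumFieldTheory.Balaban1983to89.Node00 (eventually_plaqSmallOn)
open Summit.QuantumFields.YangMills.Theorems.Prop8Chart (emlIterU)
open Summit.QuantumFields.YangMills.Theorems.Prop8ChartAllL (coe_emlIterU_unitsField_T3_allL)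
open Summit.QuantumFields.YangMills.Theorems.Prop8Criticality (expCurve_mem)
open Summit.QuantumFields.YangMills.Theorems.Prop7SymAvgGL (descendToGL logChartSym QSym)
open Summit.QuantumFields.YangMills.Theorems.Prop7SymAvgTwSym (frameTwS QTwS descendToGL_apply_eq_emlIterU)
open Summit.QuantumFields.YangMills.Theorems.Prop7SymAvgTwSymBridge (QTwS_apply_eq)
open Summit.QuantumFields.YangMills.Theorems.Prop7SymAvgRelDiffT3 (hasFDerivAt_rel_of_regPr differentiableAt_logChartSym_zero_of_regPr)
open Summit.QuantumFields.YangMills.Theorems.Prop7SymFrameBound (hasFDerivAt_frameTwS_of_regPr)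
open Summit.QuantumFields.YangMills.Theorems.Prop7TrueLinIterHasDeriv (hasDerivAt_iter_ratio)
open Summit.QuantumFields.YangMills.Theorems.Prop7FirstVariationExactPairing (tower_loop_rows_of_regPr)
open Summit.QuantumFields.YangMills.Theorems.Prop7HolRatioPerStep (coe_mul_star_self)

variable (F : T3Family) {n K : ℕ} (h : n ≤ K)

/-! ## §1 The `SU(2)` exponential curve read in units, and the GL descent of an `SU(2)` field in the regime -/

/-- The chart configuration of the EX lane along an 𝔰𝔲(2) direction IS an `SU(2)` field read in units: `(b ↦ expUnit (s•A b)·W♭ b) = (b ↦ e^{sA b}W b)♭`.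
[cite: Balaban1985Averaging, (19) p.21] -/
theorem bgUnits_expCurve (W : GaugeField (F.P K) 0 (Matrix.specialUnitaryGroup (Fin 2) ℂ))
    (A : PBond (F.P K) 0 → Matrix (Fin 2) (Fin 2) ℂ) (hA : ∀ b, A b ∈ skewAdjoint (Matrix (Fin 2) (Fin 2) ℂ)) (htr : ∀ b, (A b).trace = 0) (s : ℝ) :
    (fun b : PBond (F.P K) 0 => expUnit ((s • A) b) * bgUnits F K W b)
      = bgUnits F K (fun b => (⟨exp (s • A b) * (W b : Matrix (Fin 2) (Fin 2) ℂ), expCurve_mem (hA b) (htr b) (W b) s⟩ : Matrix.specialUnitaryGroup (Fin 2) ℂ)) := by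
  funext b
  apply Units.ext
  rw [Units.val_mul, val_expUnit, Pi.smul_apply]
  rfl

/-- Along the `SU(2)` curve `s ↦ e^{sA}·W` through a printed-regular `W`, plaquette-smallness at the regularity threshold holds for `s` near `0` (finitely many strict inequalities of
continuous functions). [cite: Balaban1985Variational, (6) p.278] -/
theorem plaqSmall_expCurve_eventually {ε₀ : ℝ} {W : GaugeField (F.P K) 0 (Matrix.specialUnitaryGroup (Fin 2) ℂ)} (hreg : RegPr F n K ε₀ W)
    (A : PBond (F.P K) 0 → Matrix (Fin 2) (Fin 2) ℂ) (hA : ∀ b, A b ∈ skewAdjoint (Matrix (Fin 2) (Fin 2) ℂ)) (htr : ∀ b, (A b).trace = 0) :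
    ∀ᶠ s : ℝ in 𝓝 0, PlaqSmall (regThreshold F n K ε₀)
      (fun b => (⟨exp (s • A b) * (W b : Matrix (Fin 2) (Fin 2) ℂ), expCurve_mem (hA b) (htr b) (W b) s⟩ : Matrix.specialUnitaryGroup (Fin 2) ℂ)) := by
  -- the curve, its origin, its continuity
  set Γ₀ : ℝ → GaugeField (F.P K) 0 (Matrix.specialUnitaryGroup (Fin 2) ℂ) :=
    fun t b => ⟨exp (t • A b) * (W b : Matrix (Fin 2) (Fin 2) ℂ), expCurve_mem (hA b) (htr b) (W b) t⟩ with hΓ₀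
  have hΓ₀0 : Γ₀ 0 = W := by
    funext b; apply Subtype.ext
    show exp ((0 : ℝ) • A b) * (W b : Matrix (Fin 2) (Fin 2) ℂ) = (W b : Matrix (Fin 2) (Fin 2) ℂ)
    rw [zero_smul, exp_zero, one_mul]
  have hcont : ∀ b : PBond (F.P K) 0, Continuous fun s : ℝ => exp (s • A b) * (W b : Matrix (Fin 2) (Fin 2) ℂ) := fun b =>
    (continuous_iff_continuousAt.2 fun s => (hasDerivAt_exp_smul_const' (A b) s).continuousAt).mul continuous_const
  have hγ : ContinuousAt (fun (s : ℝ) (b : PBond (F.P K) 0) => Γ₀ s b) 0 := by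
    refine (continuous_pi fun b => ?_).continuousAt
    exact (hcont b).subtype_mk fun s => expCurve_mem (hA b) (htr b) (W b) s
  -- strict plaquette-smallness of `W` is an open condition
  have h0 : PlaqSmallOn Set.univ (regThreshold F n K ε₀) (Γ₀ 0) := by
    rw [hΓ₀0]; exact fun p _ => hreg.1 p
  exact (eventually_plaqSmallOn hγ h0).mono fun s hs p => hs p (Set.mem_univ p)

/-- In the regime (`PlaqSmall (regThreshold F n K ε₀) U`, `10⁷L³ε₀ ≤ 1`) the GL descent of `U♭` on a comparison bond is the `(K−n)`-fold average of record of `U` read at the identified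
top-level bond: `↑(D̄_GL(U♭)(c)) = ↑(avg^{K−n}(U)(ĉ))`. [cite: Balaban1987RG1, (0.4), (0.11) p.253] -/
theorem coe_descendToGL_bgUnits {ε₀ : ℝ} (hε₀ : 0 < ε₀) (hε : 10 ^ 7 * (F.L : ℝ) ^ 3 * ε₀ ≤ 1)
    (U : GaugeField (F.P K) 0 (Matrix.specialUnitaryGroup (Fin 2) ℂ)) (hU : PlaqSmall (regThreshold F n K ε₀) U) (c : PBond (F.P n) 0) :
    ((descendToGL F n K h (bgUnits F K U) c : (Matrix (Fin 2) (Fin 2) ℂ)ˣ) : Matrix (Fin 2) (Fin 2) ℂ)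
      = ((Averaging.iter (fun i => blockAvg (P := F.P K) (j := i) (expMeanLogSU (n := Fin 2))) (K - n) U (bondShift (sites_eq F n K h) c) :
          Matrix.specialUnitaryGroup (Fin 2) ℂ) : Matrix (Fin 2) (Fin 2) ℂ) := by
  rw [descendToGL_apply_eq_emlIterU]
  exact coe_emlIterU_unitsField_T3_allL F n K hε₀ hε U hU (K - n) le_rfl _

/-- Same, for the inverse: `↑(D̄_GL(U♭)(c)⁻¹) = (↑(avg^{K−n}(U)(ĉ)))ᴴ` (the average is special unitary). [cite: Balaban1987RG1, (0.4), (0.11) p.253] -/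
theorem coe_descendToGL_bgUnits_inv {ε₀ : ℝ} (hε₀ : 0 < ε₀) (hε : 10 ^ 7 * (F.L : ℝ) ^ 3 * ε₀ ≤ 1)
    (U : GaugeField (F.P K) 0 (Matrix.specialUnitaryGroup (Fin 2) ℂ)) (hU : PlaqSmall (regThreshold F n K ε₀) U) (c : PBond (F.P n) 0) :
    (((descendToGL F n K h (bgUnits F K U) c)⁻¹ : (Matrix (Fin 2) (Fin 2) ℂ)ˣ) : Matrix (Fin 2) (Fin 2) ℂ)
      = star ((Averaging.iter (fun i => blockAvg (P := F.P K) (j := i) (expMeanLogSU (n := Fin 2))) (K - n) U (bondShift (sites_eq F n K h) c) :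
          Matrix.specialUnitaryGroup (Fin 2) ℂ) : Matrix (Fin 2) (Fin 2) ℂ) := by
  have hmul : ((descendToGL F n K h (bgUnits F K U) c : (Matrix (Fin 2) (Fin 2) ℂ)ˣ) : Matrix (Fin 2) (Fin 2) ℂ)
      * star ((Averaging.iter (fun i => blockAvg (P := F.P K) (j := i) (expMeanLogSU (n := Fin 2))) (K - n) U (bondShift (sites_eq F n K h) c) :
          Matrix.specialUnitaryGroup (Fin 2) ℂ) : Matrix (Fin 2) (Fin 2) ℂ) = 1 := by
    rw [coe_descendToGL_bgUnits F h hε₀ hε U hU c]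
    exact coe_mul_star_self _
  calc (((descendToGL F n K h (bgUnits F K U) c)⁻¹ : (Matrix (Fin 2) (Fin 2) ℂ)ˣ) : Matrix (Fin 2) (Fin 2) ℂ)
      = (((descendToGL F n K h (bgUnits F K U) c)⁻¹ : (Matrix (Fin 2) (Fin 2) ℂ)ˣ) : Matrix (Fin 2) (Fin 2) ℂ)
          * (((descendToGL F n K h (bgUnits F K U) c : (Matrix (Fin 2) (Fin 2) ℂ)ˣ) : Matrix (Fin 2) (Fin 2) ℂ)
            * star ((Averaging.iter (fun i => blockAvg (P := F.P K) (j := i) (expMeanLogSU (n := Fin 2))) (K - n) U (bondShift (sites_eq F n K h) c) :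
                Matrix.specialUnitaryGroup (Fin 2) ℂ) : Matrix (Fin 2) (Fin 2) ℂ)) := by rw [hmul, mul_one]
    _ = star ((Averaging.iter (fun i => blockAvg (P := F.P K) (j := i) (expMeanLogSU (n := Fin 2))) (K - n) U (bondShift (sites_eq F n K h) c) :
          Matrix.specialUnitaryGroup (Fin 2) ℂ) : Matrix (Fin 2) (Fin 2) ℂ) := Units.inv_mul_cancel_left _ _

/-! ## §2 ★★★ «QSYM = Q» -/

/-- ★★★ **«QSYM = Q» — THE EX LANE'S SYMMETRIC LINEARISED AVERAGE IS THE E′ LANE'S TRUE-LINEARISATION FAMILY.**  `F` a T³ family, `n ≤ K`, `0 < ε₀`, `10¹⁰L⁶ε₀ ≤ 1`,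
`W` printed-regular (`RegPr F n K ε₀ W`), `Q` ANY recursion family of the written-out true one-step linearisations along `W`'s tower (`hQ0 ∕ hQs`, the E′ letters VERBATIM), `A` an
𝔰𝔲(2)-valued bond field.  Then for every comparison bond `c`, `QSym F n K h W A c = Q (K−n) A (bondShift (sites_eq F n K h) c)`.  PROOF: differentiate `s ↦ logChartSym W (s•A) c` at `0`
in two ways — by the chain rule through `QSym = D(logChartSym W)(0)` (✓ `differentiableAt_logChartSym_zero_of_regPr`), and explicitly: for `s` near `0` it is
`log(↑avg^{K−n}(e^{sA}W)(ĉ)·(↑avg^{K−n}W(ĉ))ᴴ)` (§1), whose derivative is `Q (K−n) A ĉ` (✓ `hasDerivAt_iter_ratio` ∘ ✓ `hasFDerivAt_mlog_one`); derivatives are unique.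
[cite: Balaban1985Averaging, (11) p.19, Prop. 3 (122)-(127) p.36; Balaban1985Variational, (44) p.285; Balaban1987RG1, (0.4), (0.11) p.253] -/
theorem QSym_apply_eq_trueLinIter {ε₀ : ℝ} (hε₀ : 0 < ε₀) (hε : 10 ^ 10 * (F.L : ℝ) ^ 6 * ε₀ ≤ 1)
    (W : GaugeField (F.P K) 0 (Matrix.specialUnitaryGroup (Fin 2) ℂ)) (hreg : RegPr F n K ε₀ W)
    (Q : (k : ℕ) → (PBond (F.P K) 0 → Matrix (Fin 2) (Fin 2) ℂ) → PBond (F.P K) k → Matrix (Fin 2) (Fin 2) ℂ) (hQ0 : ∀ Y, Q 0 Y = Y)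
    (hQs : ∀ (k : ℕ) (Y : PBond (F.P K) 0 → Matrix (Fin 2) (Fin 2) ℂ) (c : PBond (F.P K) (k + 1)), Q (k + 1) Y c
      = fderiv ℂ (eml : (Idx (F.P K) → Matrix (Fin 2) (Fin 2) ℂ) → Matrix (Fin 2) (Fin 2) ℂ)
            (fun i => ((loopHol (Averaging.iter (fun i => blockAvg (P := F.P K) (j := i) (expMeanLogSU (n := Fin 2))) k W) c i :
              Matrix.specialUnitaryGroup (Fin 2) ℂ) : Matrix (Fin 2) (Fin 2) ℂ))
            (fun i => covWalkSum (Averaging.iter (fun i => blockAvg (P := F.P K) (j := i) (expMeanLogSU (n := Fin 2))) k W) (Q k Y)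
                (walk (emb c.src) (loopWord (F.P K).L c.dir (off i.1) i.2.1 i.2.2))
              * ((loopHol (Averaging.iter (fun i => blockAvg (P := F.P K) (j := i) (expMeanLogSU (n := Fin 2))) k W) c i :
                Matrix.specialUnitaryGroup (Fin 2) ℂ) : Matrix (Fin 2) (Fin 2) ℂ))
            * star ((corr (expMeanLogSU (n := Fin 2)) (Averaging.iter (fun i => blockAvg (P := F.P K) (j := i) (expMeanLogSU (n := Fin 2))) k W) c :
                Matrix.specialUnitaryGroup (Fin 2) ℂ) : Matrix (Fin 2) (Fin 2) ℂ)
          + ((corr (expMeanLogSU (n := Fin 2)) (Averaging.iter (fun i => blockAvg (P := F.P K) (j := i) (expMeanLogSU (n := Fin 2))) k W) c :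
                Matrix.specialUnitaryGroup (Fin 2) ℂ) : Matrix (Fin 2) (Fin 2) ℂ)
            * covWalkSum (Averaging.iter (fun i => blockAvg (P := F.P K) (j := i) (expMeanLogSU (n := Fin 2))) k W) (Q k Y)
                (walk (emb c.src) (List.replicate (F.P K).L (c.dir, true)))
            * star ((corr (expMeanLogSU (n := Fin 2)) (Averaging.iter (fun i => blockAvg (P := F.P K) (j := i) (expMeanLogSU (n := Fin 2))) k W) c :
                Matrix.specialUnitaryGroup (Fin 2) ℂ) : Matrix (Fin 2) (Fin 2) ℂ))
    (A : PBond (F.P K) 0 → Matrix (Fin 2) (Fin 2) ℂ) (hA : ∀ b, A b ∈ skewAdjoint (Matrix (Fin 2) (Fin 2) ℂ)) (htr : ∀ b, (A b).trace = 0)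
    (c : PBond (F.P n) 0) :
    QSym F n K h W A c = Q (K - n) A (bondShift (sites_eq F n K h) c) := by
  classical
  -- windows
  have hL3 : (3 : ℝ) ≤ (F.L : ℝ) := by
    have h3 : 3 ≤ F.L := by obtain ⟨a, ha⟩ := F.hL.1; have := F.hL.2; omega
    exact_mod_cast h3
  have hL1 : (1 : ℝ) ≤ (F.L : ℝ) := by linarith
  have hε7 : 10 ^ 7 * (F.L : ℝ) ^ 3 * ε₀ ≤ 1 := by
    have h36 : (F.L : ℝ) ^ 3 ≤ (F.L : ℝ) ^ 6 := pow_le_pow_right₀ hL1 (by norm_num)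
    nlinarith [h36, hε₀.le, pow_nonneg (zero_le_one.trans hL1) 3]
  -- the `SU(2)` exponential curve and its bond ratios
  set Γ₀ : ℝ → GaugeField (F.P K) 0 (Matrix.specialUnitaryGroup (Fin 2) ℂ) :=
    fun t b => ⟨exp (t • A b) * (W b : Matrix (Fin 2) (Fin 2) ℂ), expCurve_mem (hA b) (htr b) (W b) t⟩ with hΓ₀
  have hΓ₀0 : Γ₀ 0 = W := by
    funext b; apply Subtype.ext
    show exp ((0 : ℝ) • A b) * (W b : Matrix (Fin 2) (Fin 2) ℂ) = (W b : Matrix (Fin 2) (Fin 2) ℂ)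
    rw [zero_smul, exp_zero, one_mul]
  have hUU : ∀ b : PBond (F.P K) 0, (W b : Matrix (Fin 2) (Fin 2) ℂ) * star (W b : Matrix (Fin 2) (Fin 2) ℂ) = 1 := fun b => coe_mul_star_self _
  have hratio : ∀ b : PBond (F.P K) 0, HasDerivAt (fun s : ℝ => ((Γ₀ s b : Matrix.specialUnitaryGroup (Fin 2) ℂ) : Matrix (Fin 2) (Fin 2) ℂ) *
      star ((W b : Matrix.specialUnitaryGroup (Fin 2) ℂ) : Matrix (Fin 2) (Fin 2) ℂ)) (A b) 0 := by
    intro b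
    have h1 := (hasDerivAt_exp_smul_const' (A b) (0 : ℝ)).mul_const (W b : Matrix (Fin 2) (Fin 2) ℂ)
    simp only [zero_smul, exp_zero, mul_one] at h1
    have h2 := h1.mul_const (star ((W b : Matrix.specialUnitaryGroup (Fin 2) ℂ) : Matrix (Fin 2) (Fin 2) ℂ))
    rwa [Matrix.mul_assoc, hUU, Matrix.mul_one] at h2
  -- the E′ side: the ratio of the averages has derivative `Q (K−n) A ĉ`, hence so has its logarithm
  obtain ⟨hα, ha24, haN⟩ := tower_loop_rows_of_regPr F hε₀ hε hreg (K := K) (n := n)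
  have hQ := hasDerivAt_iter_ratio W Γ₀ hΓ₀0 A hratio Q hQ0 hQs _ (K - n) hα ha24 haN (bondShift (sites_eq F n K h) c)
  have hval0 : ((Averaging.iter (fun i => blockAvg (P := F.P K) (j := i) (expMeanLogSU (n := Fin 2))) (K - n) (Γ₀ 0) (bondShift (sites_eq F n K h) c) :
        Matrix.specialUnitaryGroup (Fin 2) ℂ) : Matrix (Fin 2) (Fin 2) ℂ)
      * star ((Averaging.iter (fun i => blockAvg (P := F.P K) (j := i) (expMeanLogSU (n := Fin 2))) (K - n) W (bondShift (sites_eq F n K h) c) :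
        Matrix.specialUnitaryGroup (Fin 2) ℂ) : Matrix (Fin 2) (Fin 2) ℂ) = 1 := by
    rw [hΓ₀0]; exact coe_mul_star_self _
  have hmlog1 : HasFDerivAt (mlog : Matrix (Fin 2) (Fin 2) ℂ → Matrix (Fin 2) (Fin 2) ℂ) (1 : Matrix (Fin 2) (Fin 2) ℂ →L[ℂ] Matrix (Fin 2) (Fin 2) ℂ)
      (((Averaging.iter (fun i => blockAvg (P := F.P K) (j := i) (expMeanLogSU (n := Fin 2))) (K - n) (Γ₀ 0) (bondShift (sites_eq F n K h) c) :
        Matrix.specialUnitaryGroup (Fin 2) ℂ) : Matrix (Fin 2) (Fin 2) ℂ)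
      * star ((Averaging.iter (fun i => blockAvg (P := F.P K) (j := i) (expMeanLogSU (n := Fin 2))) (K - n) W (bondShift (sites_eq F n K h) c) :
        Matrix.specialUnitaryGroup (Fin 2) ℂ) : Matrix (Fin 2) (Fin 2) ℂ)) := by
    rw [hval0]; exact hasFDerivAt_mlog_one
  have hlog := (hmlog1.restrictScalars ℝ).comp_hasDerivAt (0 : ℝ) hQ
  -- the EX side: the chain rule through `QSym = D(logChartSym W)(0)` along the real line `s ↦ s•A`
  have hS := differentiableAt_logChartSym_zero_of_regPr F h hε₀ hε7 W hreg
  have hQd : HasFDerivAt (logChartSym F n K h W) (QSym F n K h W) ((0 : ℝ) • A) := by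
    rw [zero_smul, Prop7SymAvgGL.QSym]; exact hS.hasFDerivAt
  have hchain := (hasDerivAt_pi.1 ((hQd.restrictScalars ℝ).comp_hasDerivAt (0 : ℝ) ((hasDerivAt_id (0 : ℝ)).smul_const A))) c
  simp only [Function.comp_def, id_eq, one_smul, ContinuousLinearMap.coe_restrictScalars'] at hchain
  -- the two real functions agree near `s = 0` (§1)
  have hev : (fun s : ℝ => logChartSym F n K h W (s • A) c) =ᶠ[𝓝 0] (mlog : Matrix (Fin 2) (Fin 2) ℂ → Matrix (Fin 2) (Fin 2) ℂ) ∘ fun s : ℝ =>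
      ((Averaging.iter (fun i => blockAvg (P := F.P K) (j := i) (expMeanLogSU (n := Fin 2))) (K - n) (Γ₀ s) (bondShift (sites_eq F n K h) c) :
        Matrix.specialUnitaryGroup (Fin 2) ℂ) : Matrix (Fin 2) (Fin 2) ℂ)
      * star ((Averaging.iter (fun i => blockAvg (P := F.P K) (j := i) (expMeanLogSU (n := Fin 2))) (K - n) W (bondShift (sites_eq F n K h) c) :
        Matrix.specialUnitaryGroup (Fin 2) ℂ) : Matrix (Fin 2) (Fin 2) ℂ) := by
    filter_upwards [plaqSmall_expCurve_eventually F (n := n) (K := K) hreg A hA htr] with s hs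
    show mlog (((descendToGL F n K h (fun b => expUnit ((s • A) b) * bgUnits F K W b) c : (Matrix (Fin 2) (Fin 2) ℂ)ˣ) : Matrix (Fin 2) (Fin 2) ℂ) *
        (((descendToGL F n K h (bgUnits F K W) c)⁻¹ : (Matrix (Fin 2) (Fin 2) ℂ)ˣ) : Matrix (Fin 2) (Fin 2) ℂ))
      = mlog (((Averaging.iter (fun i => blockAvg (P := F.P K) (j := i) (expMeanLogSU (n := Fin 2))) (K - n) (Γ₀ s) (bondShift (sites_eq F n K h) c) :
        Matrix.specialUnitaryGroup (Fin 2) ℂ) : Matrix (Fin 2) (Fin 2) ℂ)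
      * star ((Averaging.iter (fun i => blockAvg (P := F.P K) (j := i) (expMeanLogSU (n := Fin 2))) (K - n) W (bondShift (sites_eq F n K h) c) :
        Matrix.specialUnitaryGroup (Fin 2) ℂ) : Matrix (Fin 2) (Fin 2) ℂ))
    rw [bgUnits_expCurve F W A hA htr s, coe_descendToGL_bgUnits F h hε₀ hε7 _ hs c, coe_descendToGL_bgUnits_inv F h hε₀ hε7 W hreg.1 c]
  -- uniqueness of derivatives
  have key := hchain.unique (hlog.congr_of_eventuallyEq hev)
  rw [key, ContinuousLinearMap.coe_restrictScalars', one_apply_eq_self]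

/-! ## §3 ★★★ LEG in E′ letters: the twisted average differs from `Q` by a coarse pure gauge -/

/-- ★★★ **P-A1 «LEG LEMMA» IN E′ LETTERS.**  `F` a T³ family, `n ≤ K`, `0 < ε₀`, `10¹⁰L⁶ε₀ ≤ 1`, `10¹²L³ε₀ ≤ 1`, `W` printed-regular, `Q` the E′ recursion family (`hQ0 ∕ hQs`), `A`
𝔰𝔲(2)-valued.  Then print's re-based twisted linearised average (✓ `Prop7SymAvgTwSym.QTwS`, the letter of the (A′) knit) reads
`QTwS F n K h W A c = Q (K−n) A ĉ − (r c.src A − ↑(Ū ĉ)·r c.tgt A·(↑(Ū ĉ))ᴴ)`, `ĉ = bondShift (sites_eq F n K h) c`, `Ū = avg^{K−n} W`, with `r y := fderiv ℂ (A ↦ ↑(frameTwS W A y)) 0` the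
linearised symmetric accumulated frames — i.e. `Q_W A − QTwS_W A` is the COARSE PURE GAUGE `D_Ū(r(·)A)` (the leg), which the co-closed multiplier `λ_W` of ✓ `exists_multiplier_field_weakEL`
(ii) annihilates.  ✓ `QTwS_apply_eq` (product rule; `hG` ✓ `hasFDerivAt_rel_of_regPr`, `hr` ✓ `hasFDerivAt_frameTwS_of_regPr`) ∘ §2 ∘ §1.
[cite: Balaban1985Averaging, (125)-(127) p.36, (89)-(92) p.31, (97) p.32; Balaban1985BackgroundPropagators, (3.14)-(3.15), (3.19) p.393; Balaban1985Variational, (44)-(48) p.285] -/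
theorem QTwS_apply_eq_trueLinIter_sub_coarseGauge {ε₀ : ℝ} (hε₀ : 0 < ε₀) (hε : 10 ^ 10 * (F.L : ℝ) ^ 6 * ε₀ ≤ 1) (hε12 : 10 ^ 12 * (F.L : ℝ) ^ 3 * ε₀ ≤ 1)
    (W : GaugeField (F.P K) 0 (Matrix.specialUnitaryGroup (Fin 2) ℂ)) (hreg : RegPr F n K ε₀ W)
    (Q : (k : ℕ) → (PBond (F.P K) 0 → Matrix (Fin 2) (Fin 2) ℂ) → PBond (F.P K) k → Matrix (Fin 2) (Fin 2) ℂ) (hQ0 : ∀ Y, Q 0 Y = Y)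
    (hQs : ∀ (k : ℕ) (Y : PBond (F.P K) 0 → Matrix (Fin 2) (Fin 2) ℂ) (c : PBond (F.P K) (k + 1)), Q (k + 1) Y c
      = fderiv ℂ (eml : (Idx (F.P K) → Matrix (Fin 2) (Fin 2) ℂ) → Matrix (Fin 2) (Fin 2) ℂ)
            (fun i => ((loopHol (Averaging.iter (fun i => blockAvg (P := F.P K) (j := i) (expMeanLogSU (n := Fin 2))) k W) c i :
              Matrix.specialUnitaryGroup (Fin 2) ℂ) : Matrix (Fin 2) (Fin 2) ℂ))
            (fun i => covWalkSum (Averaging.iter (fun i => blockAvg (P := F.P K) (j := i) (expMeanLogSU (n := Fin 2))) k W) (Q k Y)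
                (walk (emb c.src) (loopWord (F.P K).L c.dir (off i.1) i.2.1 i.2.2))
              * ((loopHol (Averaging.iter (fun i => blockAvg (P := F.P K) (j := i) (expMeanLogSU (n := Fin 2))) k W) c i :
                Matrix.specialUnitaryGroup (Fin 2) ℂ) : Matrix (Fin 2) (Fin 2) ℂ))
            * star ((corr (expMeanLogSU (n := Fin 2)) (Averaging.iter (fun i => blockAvg (P := F.P K) (j := i) (expMeanLogSU (n := Fin 2))) k W) c :
                Matrix.specialUnitaryGroup (Fin 2) ℂ) : Matrix (Fin 2) (Fin 2) ℂ)
          + ((corr (expMeanLogSU (n := Fin 2)) (Averaging.iter (fun i => blockAvg (P := F.P K) (j := i) (expMeanLogSU (n := Fin 2))) k W) c :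
                Matrix.specialUnitaryGroup (Fin 2) ℂ) : Matrix (Fin 2) (Fin 2) ℂ)
            * covWalkSum (Averaging.iter (fun i => blockAvg (P := F.P K) (j := i) (expMeanLogSU (n := Fin 2))) k W) (Q k Y)
                (walk (emb c.src) (List.replicate (F.P K).L (c.dir, true)))
            * star ((corr (expMeanLogSU (n := Fin 2)) (Averaging.iter (fun i => blockAvg (P := F.P K) (j := i) (expMeanLogSU (n := Fin 2))) k W) c :
                Matrix.specialUnitaryGroup (Fin 2) ℂ) : Matrix (Fin 2) (Fin 2) ℂ))
    (A : PBond (F.P K) 0 → Matrix (Fin 2) (Fin 2) ℂ) (hA : ∀ b, A b ∈ skewAdjoint (Matrix (Fin 2) (Fin 2) ℂ)) (htr : ∀ b, (A b).trace = 0)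
    (c : PBond (F.P n) 0) :
    QTwS F n K h W A c
      = Q (K - n) A (bondShift (sites_eq F n K h) c)
        - (fderiv ℂ (fun A : PBond (F.P K) 0 → Matrix (Fin 2) (Fin 2) ℂ => ((frameTwS F n K h W A c.src : (Matrix (Fin 2) (Fin 2) ℂ)ˣ) : Matrix (Fin 2) (Fin 2) ℂ)) 0 A
            - ((Averaging.iter (fun i => blockAvg (P := F.P K) (j := i) (expMeanLogSU (n := Fin 2))) (K - n) W (bondShift (sites_eq F n K h) c) :
                Matrix.specialUnitaryGroup (Fin 2) ℂ) : Matrix (Fin 2) (Fin 2) ℂ)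
              * fderiv ℂ (fun A : PBond (F.P K) 0 → Matrix (Fin 2) (Fin 2) ℂ => ((frameTwS F n K h W A c.tgt : (Matrix (Fin 2) (Fin 2) ℂ)ˣ) : Matrix (Fin 2) (Fin 2) ℂ)) 0 A
              * star ((Averaging.iter (fun i => blockAvg (P := F.P K) (j := i) (expMeanLogSU (n := Fin 2))) (K - n) W (bondShift (sites_eq F n K h) c) :
                Matrix.specialUnitaryGroup (Fin 2) ℂ) : Matrix (Fin 2) (Fin 2) ℂ)) := by
  -- windows
  have hL3 : (3 : ℝ) ≤ (F.L : ℝ) := by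
    have h3 : 3 ≤ F.L := by obtain ⟨a, ha⟩ := F.hL.1; have := F.hL.2; omega
    exact_mod_cast h3
  have hL1 : (1 : ℝ) ≤ (F.L : ℝ) := by linarith
  have hε7 : 10 ^ 7 * (F.L : ℝ) ^ 3 * ε₀ ≤ 1 := by
    have h36 : (F.L : ℝ) ^ 3 ≤ (F.L : ℝ) ^ 6 := pow_le_pow_right₀ hL1 (by norm_num)
    nlinarith [h36, hε₀.le, pow_nonneg (zero_le_one.trans hL1) 3]
  -- the bridge's two differentiability rows, discharged at `RegPr`
  have hG := hasFDerivAt_rel_of_regPr F h hε₀ hε7 W hreg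
  have hr := hasFDerivAt_frameTwS_of_regPr F h hε₀ hε12 W hreg
  rw [QTwS_apply_eq F h W hG hr A c, QSym_apply_eq_trueLinIter F h hε₀ hε W hreg Q hQ0 hQs A hA htr c,
    coe_descendToGL_bgUnits F h hε₀ hε7 W hreg.1 c, coe_descendToGL_bgUnits_inv F h hε₀ hε7 W hreg.1 c]

end Summit.QuantumFields.YangMills.Theorems.Prop7QSymEqTrueLinIter

end
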